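import Mathlib
import HarnessLib
import Summits.HubbardSuperconductivity.HubbardSuperconductivity.Theorems.KLProgrammeKLRegimeEngineCDThresholdsLow
import Summits.HubbardSuperconductivity.HubbardSuperconductivity.Theorems.KLProgrammeKLRegimeEngineCDThresholdsX3

/-!
# Route `KLProgramme` — crux K3 ENGINE (stmt-…-20437) stub (b) conj. 2 «(c-D)² FAMILY TELESCOPE», brick (D3′): the band-increment threshold `X3`
# re-threaded for a multiplier whose ORDER-THREE datum is x-LINEAR (`α₃ ↦ α₃ + α₃′·x`: the scale-J fat pair on the depth-x flow frame `K̊_m`)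

Cell `gate-hubbard-kl`, seat hubbard-kl-k3c3-p2 (g10); (R68c); design F1-DESIGN.md §5 (D3′).  In the two-defect split of the family+band telescope the
covariance-defect term at fixed family is the (c-D) chain of record (`…SectorSliceIncrRates.incr_rate_three_le`, `…EngineCDThresholdsLow/X3`) EXCEPT that the
family's fat pair now lives on the depth-`x` frame, whose third derivative is `b₃ + b₃′x`: its order-three datum becomes `α₃ + α₃′x` (`α₃′ = 16G₁ᶠb₃′Λ_f²/Λ_f³`).
Of the five thresholds only `X3` sees `α₃`, through the single monomial `G₀k₁α₃`; so:

* `cd_threshold_X3_famlin_of` — the splitter: `3·X3(α₃) ≤ k₁G₃(x/4)³` and `64·G₀α₃′ ≤ 21·G₃x²` ⇒ `3·X3(α₃ + α₃′x) ≤ k₁G₃x³`;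
* `cd_threshold_famlin_aux` — the extra condition from the depth `1024e₀² ≤ x·u²Λ²` and ONE `u`-smallness `u·(64g₀a₃″) ≤ 21504·g₃e₀` (`α₃′ = a₃″u²/Λ`: `p = 3 ≥ 2`);
* **`cd_threshold_X3_famlin`** — the assembled threshold at depth `4096e₀² ≤ x·u²Λ²` (ONE level below the (c-D) base), same smallness as `cd_threshold_X3` plus the one above;
* `cd_depth_lower_succ` — `m ≥ 2j + 6 + ⌈log₄(U²)⁻¹⌉₊ ⇒ 4096e₀² ≤ 4^m·(U²Λ_j²)`.

Pure real algebra; no definitions, no sorry.  Nothing asserts superconductivity. [cite: BenfattoGiulianiMastropietro2006, §3 (3.2)–(3.8)]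
-/

noncomputable section

namespace Summit.HubbardSuperconductivity.HubbardSuperconductivity.Theorems.EngineV8

set_option linter.dupNamespace false -- summit = problem name (single-conjunct summit), D-0017

open Real

/-- **Splitter**: the `X3` threshold for the x-linear order-three datum `α₃ + α₃′x` from the constant-datum threshold ONE LEVEL DEEPER (`x/4`) and the
condition `64·G₀α₃′ ≤ 21·G₃x²`. [cite: BenfattoGiulianiMastropietro2006, §3 (3.2)] -/
theorem cd_threshold_X3_famlin_of {k₁ k₂ k₃ k₄ G₀ G₁ G₂ G₃ b₁ b₂ b₂' b₃ α₁ α₂ α₃ α₃' x : ℝ} (hk₁ : 0 ≤ k₁) (hx : 0 ≤ x)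
    (h0 : 3 * ((3 * G₀ * k₃ * α₁ * b₁ ^ 2 + G₀ * k₄ * b₁ ^ 3 + 3 * G₀ * G₁ * k₃ * b₂' + 3 * G₀ * G₂ * k₂ * α₁ + 3 * G₀ * G₂ * k₃ * b₁ + 3 * G₀ * k₂ * α₁ * b₂ +
      3 * G₀ * k₂ * α₂ * b₁ + 3 * G₀ * k₃ * b₁ * b₂ + 3 * G₁ ^ 2 * k₂ * α₁ + 3 * G₁ ^ 2 * k₃ * b₁ + G₀ * k₁ * α₃ + G₀ * k₂ * b₃) +
      (6 * G₀ * G₁ * k₃ * α₁ * b₁ + 3 * G₀ * G₁ * k₄ * b₁ ^ 2 + 3 * G₀ * G₁ * G₂ * k₃ + 3 * G₀ * G₁ * k₂ * α₂ + 3 * G₀ * G₁ * k₃ * b₂ + G₁ ^ 3 * k₃) +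
      (3 * G₀ * G₁ ^ 2 * k₃ * α₁ + 3 * G₀ * G₁ ^ 2 * k₄ * b₁) + (G₀ * G₁ ^ 3 * k₄)) ≤ k₁ * G₃ * (x / 4) ^ 3)
    (h1 : 64 * G₀ * α₃' ≤ 21 * G₃ * x ^ 2) :
    3 * ((3 * G₀ * k₃ * α₁ * b₁ ^ 2 + G₀ * k₄ * b₁ ^ 3 + 3 * G₀ * G₁ * k₃ * b₂' + 3 * G₀ * G₂ * k₂ * α₁ + 3 * G₀ * G₂ * k₃ * b₁ + 3 * G₀ * k₂ * α₁ * b₂ +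
      3 * G₀ * k₂ * α₂ * b₁ + 3 * G₀ * k₃ * b₁ * b₂ + 3 * G₁ ^ 2 * k₂ * α₁ + 3 * G₁ ^ 2 * k₃ * b₁ + G₀ * k₁ * (α₃ + α₃' * x) + G₀ * k₂ * b₃) +
      (6 * G₀ * G₁ * k₃ * α₁ * b₁ + 3 * G₀ * G₁ * k₄ * b₁ ^ 2 + 3 * G₀ * G₁ * G₂ * k₃ + 3 * G₀ * G₁ * k₂ * α₂ + 3 * G₀ * G₁ * k₃ * b₂ + G₁ ^ 3 * k₃) +
      (3 * G₀ * G₁ ^ 2 * k₃ * α₁ + 3 * G₀ * G₁ ^ 2 * k₄ * b₁) + (G₀ * G₁ ^ 3 * k₄)) ≤ k₁ * G₃ * x ^ 3 := by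
  have h1' : 3 * (G₀ * k₁ * (α₃' * x)) ≤ 63 / 64 * (k₁ * G₃ * x ^ 3) := by
    have := mul_le_mul_of_nonneg_left h1 (mul_nonneg hk₁ hx)
    nlinarith [this]
  nlinarith [h0, h1']

/-- **The extra condition** `64·G₀α₃′ ≤ 21·G₃x²` in the flow currency (`G₀ = g₀u`, `G₃ = g₃u²`, `α₃′ = a₃″u²/Λ`, `0 < u ≤ 1`, `0 < Λ ≤ e₀`) at any depth
`1024e₀² ≤ x·u²Λ²`, from ONE u-smallness `u·(64g₀a₃″) ≤ 21504·g₃e₀`. [cite: BenfattoGiulianiMastropietro2006, §3 (3.2)] -/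
theorem cd_threshold_famlin_aux {g₀ g₃ a₃'' e₀ Λ u x G₀ G₃ α₃' : ℝ} (hg₀ : 0 ≤ g₀) (hg₃ : 0 ≤ g₃) (ha : 0 ≤ a₃'')
    (hΛ : 0 < Λ) (hΛe : Λ ≤ e₀) (hu0 : 0 < u) (hu1 : u ≤ 1) (hx : 1024 * e₀ ^ 2 ≤ x * (u ^ 2 * Λ ^ 2))
    (hG₀ : G₀ = g₀ * u) (hG₃ : G₃ = g₃ * u ^ 2) (hα₃' : α₃' = a₃'' * u ^ 2 / Λ)
    (hU : u * (64 * g₀ * a₃'') ≤ 21504 * g₃ * e₀) : 64 * G₀ * α₃' ≤ 21 * G₃ * x ^ 2 := by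
  subst hG₀ hG₃ hα₃'
  have he : 0 < e₀ := lt_of_lt_of_le hΛ hΛe
  have hw0 : 0 < u ^ 2 * Λ ^ 2 := by positivity
  have h1 : u ^ 2 * Λ ^ 2 ≤ e₀ ^ 2 := by
    have hu2 : u ^ 2 ≤ 1 := pow_le_one₀ hu0.le hu1
    have hΛ2 : Λ ^ 2 ≤ e₀ ^ 2 := pow_le_pow_left₀ hΛ.le hΛe 2
    nlinarith [pow_nonneg hΛ.le 2]
  have hx1 : 1 ≤ x := by
    have : 1024 * (u ^ 2 * Λ ^ 2) ≤ x * (u ^ 2 * Λ ^ 2) := le_trans (by nlinarith [h1]) hx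
    have := le_of_mul_le_mul_right this hw0
    linarith
  have hx0 : 0 ≤ x := le_trans zero_le_one hx1
  -- `21 g₃ u² x² ≥ 21 g₃ u² x ≥ 21·1024 g₃ e₀²/Λ²·(1)`; need `64 g₀ u a₃″ u²/Λ ≤ that`
  rw [show 64 * (g₀ * u) * (a₃'' * u ^ 2 / Λ) = 64 * g₀ * a₃'' * u ^ 3 / Λ by ring]
  rw [div_le_iff₀ hΛ]
  have hxx : x ≤ x ^ 2 := by nlinarith
  have step : 1024 * e₀ ^ 2 * (21 * g₃) ≤ 21 * (g₃ * u ^ 2) * x ^ 2 * Λ ^ 2 := by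
    have := mul_le_mul_of_nonneg_right hx (show 0 ≤ 21 * g₃ by positivity)
    nlinarith [mul_le_mul_of_nonneg_left hxx (show 0 ≤ 21 * g₃ * u ^ 2 * Λ ^ 2 by positivity)]
  -- `64 g₀ a₃″ u³ Λ ≤ 64 g₀ a₃″ u e₀ ≤ 21504 g₃ e₀ · e₀ = 1024·21 g₃ e₀²`
  have hu3 : u ^ 3 ≤ u := by nlinarith [pow_le_one₀ hu0.le hu1 (n := 2)]
  have t : 64 * g₀ * a₃'' * u ^ 3 * Λ ≤ 64 * g₀ * a₃'' * u * e₀ :=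
    mul_le_mul (mul_le_mul_of_nonneg_left hu3 (by positivity)) hΛe hΛ.le (by positivity)
  have t2 : 64 * g₀ * a₃'' * u * e₀ ≤ 21504 * g₃ * e₀ * e₀ := by
    have := mul_le_mul_of_nonneg_right hU he.le; nlinarith [this]
  nlinarith [t, t2, step, pow_nonneg hΛ.le 2, sq_nonneg Λ]

set_option maxHeartbeats 400000 in
/-- **Threshold `X3` for the x-linear order-three datum** (family fat pair on the depth-x frame): at depth `4096e₀² ≤ x·u²Λ²` (ONE level below the (c-D) base)
the condition `3·X3(α₃ + α₃′x) ≤ k₁G₃x³` holds under the smallness of `cd_threshold_X3` and `u·(64g₀a₃″) ≤ 21504·g₃e₀`.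
[cite: BenfattoGiulianiMastropietro2006, §3 (3.2)–(3.8)] -/
theorem cd_threshold_X3_famlin {κ₁ κ₂ κ₃ κ₄ g₀ g₁ g₂ g₃ a₁ a₂ a₃ a₃'' b₁ b₂ b₂' b₃ e₀ Λ u x k₁ k₂ k₃ k₄ G₀ G₁ G₂ G₃ α₁ α₂ α₃ α₃' : ℝ}
    (hκ₁ : 0 ≤ κ₁) (hκ₂ : 0 ≤ κ₂) (hκ₃ : 0 ≤ κ₃) (hκ₄ : 0 ≤ κ₄) (hg₀ : 0 ≤ g₀) (hg₁ : 0 ≤ g₁) (hg₂ : 0 ≤ g₂) (hg₃ : 0 ≤ g₃)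
    (ha₁ : 0 ≤ a₁) (ha₂ : 0 ≤ a₂) (ha₃ : 0 ≤ a₃) (ha₃'' : 0 ≤ a₃'') (hb₁ : 0 ≤ b₁) (hb₂ : 0 ≤ b₂) (hb₂' : 0 ≤ b₂') (hb₃ : 0 ≤ b₃)
    (hΛ : 0 < Λ) (hΛe : Λ ≤ e₀) (hu0 : 0 < u) (hu1 : u ≤ 1) (hx : 4096 * e₀ ^ 2 ≤ x * (u ^ 2 * Λ ^ 2))
    (hk₁ : k₁ = κ₁ / Λ ^ 2) (hk₂ : k₂ = κ₂ / Λ ^ 3) (hk₃ : k₃ = κ₃ / Λ ^ 4) (hk₄ : k₄ = κ₄ / Λ ^ 5) (hG₀ : G₀ = g₀ * u) (hG₁ : G₁ = g₁ * u ^ 2)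
    (hG₂ : G₂ = g₂ * u ^ 2) (hG₃ : G₃ = g₃ * u ^ 2) (hα₁ : α₁ = a₁ / Λ) (hα₂ : α₂ = a₂ / Λ ^ 2) (hα₃ : α₃ = a₃ / Λ ^ 3) (hα₃' : α₃' = a₃'' * u ^ 2 / Λ)
    (hU : 3 * (u * (3 * a₁ * b₁ ^ 2 * g₀ * κ₃ * e₀ ^ 3 + b₁ ^ 3 * g₀ * κ₄ * e₀ ^ 3 + 3 * b₂' * g₀ * g₁ * κ₃ * e₀ ^ 4 + 3 * a₁ * g₀ * g₂ * κ₂ * e₀ ^ 4 +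
      3 * b₁ * g₀ * g₂ * κ₃ * e₀ ^ 4 + 3 * a₁ * b₂ * g₀ * κ₂ * e₀ ^ 4 + 3 * a₂ * b₁ * g₀ * κ₂ * e₀ ^ 3 + 3 * b₁ * b₂ * g₀ * κ₃ * e₀ ^ 4 + 3 * a₁ * g₁ ^ 2 * κ₂ * e₀ ^ 4 +
      3 * b₁ * g₁ ^ 2 * κ₃ * e₀ ^ 4 + a₃ * g₀ * κ₁ * e₀ ^ 3 + b₃ * g₀ * κ₂ * e₀ ^ 5 + 6 * a₁ * b₁ * g₀ * g₁ * κ₃ * e₀ ^ 3 + 3 * b₁ ^ 2 * g₀ * g₁ * κ₄ * e₀ ^ 3 +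
      3 * g₀ * g₁ * g₂ * κ₃ * e₀ ^ 4 + 3 * a₂ * g₀ * g₁ * κ₂ * e₀ ^ 3 + 3 * b₂ * g₀ * g₁ * κ₃ * e₀ ^ 4 + g₁ ^ 3 * κ₃ * e₀ ^ 4 + 3 * a₁ * g₀ * g₁ ^ 2 * κ₃ * e₀ ^ 3 +
      3 * b₁ * g₀ * g₁ ^ 2 * κ₄ * e₀ ^ 3 + g₀ * g₁ ^ 3 * κ₄ * e₀ ^ 3)) ≤ 1073741824 * κ₁ * g₃ * e₀ ^ 6)
    (hU' : u * (64 * g₀ * a₃'') ≤ 21504 * g₃ * e₀) :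
    3 * ((3 * G₀ * k₃ * α₁ * b₁ ^ 2 + G₀ * k₄ * b₁ ^ 3 + 3 * G₀ * G₁ * k₃ * b₂' + 3 * G₀ * G₂ * k₂ * α₁ + 3 * G₀ * G₂ * k₃ * b₁ + 3 * G₀ * k₂ * α₁ * b₂ +
      3 * G₀ * k₂ * α₂ * b₁ + 3 * G₀ * k₃ * b₁ * b₂ + 3 * G₁ ^ 2 * k₂ * α₁ + 3 * G₁ ^ 2 * k₃ * b₁ + G₀ * k₁ * (α₃ + α₃' * x) + G₀ * k₂ * b₃) +
      (6 * G₀ * G₁ * k₃ * α₁ * b₁ + 3 * G₀ * G₁ * k₄ * b₁ ^ 2 + 3 * G₀ * G₁ * G₂ * k₃ + 3 * G₀ * G₁ * k₂ * α₂ + 3 * G₀ * G₁ * k₃ * b₂ + G₁ ^ 3 * k₃) +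
      (3 * G₀ * G₁ ^ 2 * k₃ * α₁ + 3 * G₀ * G₁ ^ 2 * k₄ * b₁) + (G₀ * G₁ ^ 3 * k₄)) ≤ k₁ * G₃ * x ^ 3 := by
  have hx4 : 1024 * e₀ ^ 2 ≤ x / 4 * (u ^ 2 * Λ ^ 2) := by linarith
  have hx1 : 1024 * e₀ ^ 2 ≤ x * (u ^ 2 * Λ ^ 2) := by
    have : (0 : ℝ) ≤ 3072 * e₀ ^ 2 := by positivity
    linarith
  have h0 := cd_threshold_X3 hκ₁ hκ₂ hκ₃ hκ₄ hg₀ hg₁ hg₂ hg₃ ha₁ ha₂ ha₃ hb₁ hb₂ hb₂' hb₃ hΛ hΛe hu0 hu1 hx4 hk₁ hk₂ hk₃ hk₄ hG₀ hG₁ hG₂ hG₃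
    hα₁ hα₂ hα₃ hU
  have h1 := cd_threshold_famlin_aux hg₀ hg₃ ha₃'' hΛ hΛe hu0 hu1 hx1 hG₀ hG₃ hα₃' hU'
  have hk₁0 : 0 ≤ k₁ := by rw [hk₁]; positivity
  have hx0 : 0 ≤ x := by
    have he : 0 < e₀ := lt_of_lt_of_le hΛ hΛe
    have hpos : 0 < x * (u ^ 2 * Λ ^ 2) := lt_of_lt_of_le (by positivity) hx
    by_contra h
    exact absurd hpos (not_lt.2 (mul_nonpos_of_nonpos_of_nonneg (not_le.1 h).le (by positivity)))
  exact cd_threshold_X3_famlin_of hk₁0 hx0 h0 h1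

/-- **Depth, one level below the (c-D) base**: `m ≥ 2j + 6 + ⌈log₄(U²)⁻¹⌉₊ ⇒ 4096·e₀² ≤ 4^m·(U²·Λ_j²)`. [cite: BenfattoGiulianiMastropietro2006, §3 (3.2)] -/
theorem cd_depth_lower_succ {e₀ U : ℝ} (he : 0 < e₀) (hU : 0 < |U|) (hU1 : |U| ≤ 1) {j m : ℕ} (hm : 2 * j + 6 + ⌈Real.logb 4 (U ^ 2)⁻¹⌉₊ ≤ m) :
    4096 * e₀ ^ 2 ≤ (4 : ℝ) ^ m * (|U| ^ 2 * (e₀ * ((4 : ℝ) ^ j)⁻¹) ^ 2) := by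
  obtain ⟨m', rfl⟩ : ∃ m', m = m' + 1 := ⟨m - 1, by omega⟩
  have h := cd_depth_lower he hU hU1 (j := j) (m := m') (by omega)
  calc 4096 * e₀ ^ 2 = 4 * (1024 * e₀ ^ 2) := by ring
    _ ≤ 4 * ((4 : ℝ) ^ m' * (|U| ^ 2 * (e₀ * ((4 : ℝ) ^ j)⁻¹) ^ 2)) := by linarith
    _ = (4 : ℝ) ^ (m' + 1) * (|U| ^ 2 * (e₀ * ((4 : ℝ) ^ j)⁻¹) ^ 2) := by ring

end Summit.HubbardSuperconductivity.HubbardSuperconductivity.Theorems.EngineV8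

end
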